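import Summits.RiemannHypothesis.RiemannHypothesis.Theorems.TiltedLandingLaw421R3Lens1Shape

/-!
# W-08 · lens-1 gen 4 — MODULE «SHAPE COVER / SELF»: gap cuts, the off-column hang clause, the in-band box door, the SELF-shadow door,
the lineage continuation, and the push report

Cell rh-split, seat `rh33346-lens-1-g4` (LENS 1 = signed Jensen cuts / coverage) for crux ⟨33346⟩ `TiltedLandingLaw421R` (route
EarlyAppointments), SUCC side, NODE v11 §4 leaf (O2-a1).  SUPPORT only, typed over LANDED modules (`…R3Lens1SignCut` #1143) and the images
of record `…R3Lens1CoverageRS/RS2`, `…R3Lens1Shape` (lead queue (3i′)(3i″)(3k)); target `…/Theorems/TiltedLandingLaw421R3Lens1ShapeCover.lean`,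
namespace `RhW08.Lens1Shape` (no re-declaration; FQN-cites); 0 `sorry`, no new axioms, no instances, no notation.  HONEST LABEL: nothing here bears
on the truth of RH; RH is NOT proved; ⟨33346⟩/⟨33347⟩ stay OPEN (these are DOORS = sufficient conditions; the residual `RegHungCut10S` is untouched).
CHECK STATUS: cannot elaborate by import until `…R3Lens1Shape` is built (image SHAPE-v4 = v3 with the private-helper token fixed); the inline probe
`lens-1/ShapeCoverSelf-v1-probe.lean` (landed `…R3Lens1SignCut` + `…R3Lens1CoverageR` IMPORTED; RS v1, RS2 v2, SHAPE v4 bodies inlined verbatim;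
this body appended) gives farm rc 0 · 0 err · 0 warn · 0 sorry · axioms [propext, Classical.choice, Quot.sound] for `succ_of_selfShadowR_le`,
`colCouple_succ_of_selfShadowR`, `hungBox_of_selfShadowL`.

THE SELF OBJECT (NODE v11 §4 (a1)).  First uncuttable level `i₀`, a column couple `c = σ + it` of `F = f^{(i₀)}` (`|σ − x₀| < R/2`,
`0 < t ≤ Hs ≤ R/2`) whose OWN closed Jensen disc reaches past a column wall: `x₀ + R/2 < σ + t` (right; the disc cannot reach both walls since
`2t ≤ 2Hs ≤ R`).  Every vertical `β ∈ (σ, x₀ + R/2]` then passes through `D̄(c)` at heights `< t`, so no column bracket exists on that side;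
the door must CROSS THE WALL.  `hangClause_of_corner` cannot do it with a free top (`min(H, Hs) = Hs` forces `|β − x₀| ≤ R/2`), and a low
corner box either misses `c` (`H ≤ t`) or needs a signed top edge below the strip; the right tool is the JOIN of the two landed hang clauses:
points of the box inside the closed column satisfy the level-`(i+1)` band inequality outright (`ρ = 0`, `Im z ≤ Im a ≤ Hs`), points beyond the
wall hang under a host whose disc pokes out of the column, and only THOSE hosts need to be level-`i` band points (`hangClause_of_offColumn`).
With the TANGENT GAP `β := σ + t` (the abscissa where `D̄(c)` leaves the axis region: `c` does not shadow it, `|β − σ| = t`), a left cut `α`, good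
feet and in-band cap intruders, `[α, σ+t] × [−(Hs+1), Hs+1]` is a HUNG BOX at level `i₀` (`hungBox_of_selfShadowR`), hence successor-or-`ReadyR2`
AT LEVEL `i₀` (`succ_or_readyR2_of_selfShadowR`).

THE PUSH REPORT (honest).  `ReadyR2` at `i₀` contradicts ¬`ReadyR2` at `j` (`readyR2_mono`); a level-`(i₀+1)` band state is the crux's successor
iff `i₀ = j`.  For `i₀ < j` NO cumulative datum of the A3′ object (cuttable below `i₀`, `ColCouple ∀ k ≤ i₀`, ¬`ReadyR2` up to `j`, `IsLowest`,
`CumReady`) converts a level-`(i₀+1)` band state into a level-`(j+1)` one: the central lineage consumes COLUMN couples, and the child that ¬local A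
puts in the self box may sit in the protruding cap `[x₀ + R/2, σ + t) × (0, Hs+1)`.  The MISSING DATUM is therefore a per-level door at levels
`i₀+1 … j` — minimally, column membership of the level-`(i₀+1)` child (`colCouple_succ_of_selfShadowR`: a child-free cap continues the lineage).
Kernel fact behind it: the lineage binder is implied by ¬`HungBox_j` ∧ ¬`ReadyR2_j` (a fully cuttable history gives a column bracket at level `j`,
which IS a hung box by `corner_of_columnBase` + `hangClause_of_corner`), so it NAMES the inhabitant but adds no coverage ({K-CC} ⊆ {K-HB}, NODE v11 §3).
-/

namespace RhW08.Lens1Shape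

set_option linter.dupNamespace false

open Complex Set
open scoped ComplexConjugate
open Literature.Analysis.Complex
open Summit.RiemannHypothesis.RiemannHypothesis.Theorems.Splittings.JensenWindow
open RhIdea6.G17.W07C7 RhIdea6.G17.W07C7.Rev6 RhIdea6.G18.W07C8.Law421BirthS RhIdea6.G19.W07C11.Seam
open RhIdea6.G20.W07C12.Frac RhIdea6.G20.W07C12.StColP RhW07.C12.FieldSplit RhIdea6.G21.W07C13.TentMax
open RhW07.C14.TwoSided RhW07.C14.Classes RhW07.C14.Lineage RhW07.C14.Booking
open RhW07.C13.Heredity RhIdea6.G22.W07C15pre.Injection RhW07.E3.Cell RhW07.E3.Lit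
open RhW08.Round1 RhW08.StSwap RhW08.Round2 RhW08.QuadW RhW08.SealSwapQ RhW08.SealSwap RhW08.SuccB RhW08.SuccSplit
open RhW08.SuccTheft RhW08.Column RhW08.Hurwitz RhW08.ClusterQ RhW08.ClusterQM RhW08.NewtonDoor RhW08.NewtonDoorGenusOne RhW08.PurseP
open RhW08.AntiEscapeSplit7
open RhW08.Lens1SignCut RhW08.Lens1Coverage RhW08.LineageQ

/-! ## §1 Gap cuts: an unshadowed abscissa with good feet is a signed vertical transversal -/

/-- ★ DISC CRITERION: if no non-real zero `a` of `f^{(i)}` has `|x − Re a| < |Im a|` (the open real shadow of every Jensen disc misses `x`),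
then `x` is NOT shadowed (at any height).  The tangent abscissa `Re c + Im c` of a disc is never shadowed by that disc. -/
theorem not_shadowed_of_discs {f : ℂ → ℂ} {Hs : ℝ} (i : ℕ) {x : ℝ}
    (h : ∀ a : ℂ, iteratedDeriv i f a = 0 → a.im ≠ 0 → |a.im| ≤ |x - a.re|) : ¬ Shadowed f Hs i x := by
  rintro ⟨y, hy, hns⟩
  apply hns
  intro a ha haim
  have hre : (((x : ℂ) + (y : ℂ) * I) - (a.re : ℂ)).re = x - a.re := by simp
  have him : (((x : ℂ) + (y : ℂ) * I) - (a.re : ℂ)).im = y := by simp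
  have hsq : (x - a.re) ^ 2 < ‖((x : ℂ) + (y : ℂ) * I) - (a.re : ℂ)‖ ^ 2 := by
    rw [Complex.sq_norm, Complex.normSq_apply, hre, him]
    nlinarith [hy.1]
  have hlt : |x - a.re| < ‖((x : ℂ) + (y : ℂ) * I) - (a.re : ℂ)‖ := abs_lt_of_sq_lt_sq hsq (norm_nonneg _)
  exact lt_of_le_of_lt (h a ha haim) hlt

/-- ★ GAP CUT: on a legal frame (`f^{(i)}` with a zero), an unshadowed abscissa carries the boundary sign `Im (F′/F) < 0` at every height
`y ∈ (0, Hs]` (`sgn_of_jensenClear`, Kim 1996 (2.3)). -/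
theorem signedCut_of_not_shadowed {η : ℝ} {f : ℂ → ℂ} {x₀ s hmax R Hs : ℝ} {B : ℕ} (hE : EngineHyps5 2 η f x₀ s hmax R Hs B) (i : ℕ)
    (hex : ∃ a, iteratedDeriv i f a = 0) {x : ℝ} (hS : ¬ Shadowed f Hs i x) :
    ∀ y ∈ Ioc (0 : ℝ) Hs,
      (deriv (iteratedDeriv i f) ((x : ℂ) + (y : ℂ) * I) / iteratedDeriv i f ((x : ℂ) + (y : ℂ) * I)).im < 0 := by
  intro y hy
  have imS : ((x : ℂ) + (y : ℂ) * I).im = y := by simp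
  have hcl : JensenClear (iteratedDeriv i f) ((x : ℂ) + (y : ℂ) * I) := by
    by_contra hc
    exact hS ⟨y, hy, hc⟩
  have h1 := sgn_of_jensenClear (realEntireLt2_of_hyps hE) i hex (w := (x : ℂ) + (y : ℂ) * I) (by rw [imS]; exact hy.1.ne') hcl
  rw [imS] at h1
  exact neg_of_mul_neg_right h1 hy.1.le

/-! ## §2 The off-column hang clause (join of `hangClause_of_inBand` and `hangClause_of_corner`) and the in-band box door -/

/-- ★★ OFF-COLUMN HANG CLAUSE.  For the full-height box `[α, β] × (0, Hs+1)` at level `i`: a point under a host's closed disc that lies in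
the closed column satisfies the level-`(i+1)` band inequality outright; a point beyond a wall lies strictly inside the host's open shadow, so the
host's disc pokes out of the column (`R/2 < |Re a − x₀| + Im a`) and its shadow meets `(α, β)` — and only such hosts are asked to be level-`i`
band points (then Jensen nesting `band_step'`). -/
theorem hangClause_of_offColumn {η : ℝ} {f : ℂ → ℂ} {x₀ s hmax R Hs : ℝ} {B i : ℕ} (hE : EngineHyps5 2 η f x₀ s hmax R Hs B)
    (hnz : iteratedDeriv i f ≠ 0) {α β : ℝ}
    (hout : ∀ a : ℂ, iteratedDeriv i f a = 0 → 0 < a.im → α < a.re + a.im → a.re - a.im < β → R / 2 < |a.re - x₀| + a.im →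
      (max (|a.re - x₀| - R / 2) 0) ^ 2 + (i : ℝ) * a.im ^ 2 ≤ (i : ℝ) * Hs ^ 2) :
    HangClause (iteratedDeriv i f) x₀ R Hs i α β (Hs + 1) := by
  intro a z ha hapos hz hdisc
  rw [mem_reProdIm] at hz
  obtain ⟨⟨hzα, hzβ⟩, hz0, -⟩ := hz
  have haHs : a.im ≤ Hs := by
    have h1 := abs_im_le_of_level hE hnz ha
    rwa [abs_of_pos hapos] at h1
  have haHs2 : a.im ^ 2 ≤ Hs ^ 2 := by nlinarith
  have hzim2 : z.im ^ 2 ≤ Hs ^ 2 := by nlinarith [sq_nonneg (z.re - a.re)]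
  have hj : (0 : ℝ) ≤ (i : ℝ) + 1 := by positivity
  by_cases hcol : |z.re - x₀| ≤ R / 2
  · -- a point of the closed column: the level-(i+1) band inequality outright
    have hmax : max (|z.re - x₀| - R / 2) 0 = 0 := max_eq_right (by linarith)
    rw [hmax]
    nlinarith [mul_le_mul_of_nonneg_left hzim2 hj]
  · -- a point beyond a wall: strictly inside the host's open shadow, so the host pokes out of the column
    push Not at hcol
    have hz2 : 0 < z.im ^ 2 := by positivity
    have hsh : (z.re - a.re) ^ 2 < a.im ^ 2 := by linarith
    have hsh' : |z.re - a.re| < a.im := abs_lt_of_sq_lt_sq hsh hapos.le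
    obtain ⟨hl, hr⟩ := abs_lt.1 hsh'
    have h1 : α < a.re + a.im := by linarith
    have h2 : a.re - a.im < β := by linarith
    have h3 : R / 2 < |a.re - x₀| + a.im := by
      have htri : |z.re - x₀| ≤ |z.re - a.re| + |a.re - x₀| := by
        have := abs_add_le (z.re - a.re) (a.re - x₀)
        rwa [show z.re - a.re + (a.re - x₀) = z.re - x₀ by ring] at this
      linarith
    exact band_step' (hout a ha hapos h1 h2 h3) haHs2 (by unfold NestedStep; linarith)

/-- ★★ THE IN-BAND BOX DOOR («K-GAP», instrumentable on zero positions + two sign checks).  Legal frame, `f^{(i)} ≢ 0`, two vertical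
transversals `α < β` in the LAW's range signed on heights `(0, Hs]` with `F·F′ ≠ 0` at their feet (e.g. gap cuts, §1), a couple of `f^{(i)}`
with real part in `(α, β)`, and every upper zero whose disc pokes out of the closed column and whose shadow meets `(α, β)` a level-`i` band point
⇒ `HungBox f x₀ R Hs i` (free top `signedRect_of_cuts`, `hangClause_of_offColumn`).  Contains the column-cut box (there `hout` is idle). -/
theorem hungBox_of_cuts_inBand {η : ℝ} {f : ℂ → ℂ} {x₀ s hmax R Hs : ℝ} {B i : ℕ} (hE : EngineHyps5 2 η f x₀ s hmax R Hs B)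
    (hnz : iteratedDeriv i f ≠ 0) {α β : ℝ}
    (hαr : x₀ - ((i : ℝ) + 3) * R / 2 ≤ α) (hβr : β ≤ x₀ + ((i : ℝ) + 3) * R / 2) (hlt : α < β)
    (hFα : iteratedDeriv i f α ≠ 0) (hFβ : iteratedDeriv i f β ≠ 0)
    (hdα : deriv (iteratedDeriv i f) α ≠ 0) (hdβ : deriv (iteratedDeriv i f) β ≠ 0)
    (hsα : ∀ y ∈ Ioc (0 : ℝ) Hs,
      (deriv (iteratedDeriv i f) ((α : ℂ) + (y : ℂ) * I) / iteratedDeriv i f ((α : ℂ) + (y : ℂ) * I)).im < 0)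
    (hsβ : ∀ y ∈ Ioc (0 : ℝ) Hs,
      (deriv (iteratedDeriv i f) ((β : ℂ) + (y : ℂ) * I) / iteratedDeriv i f ((β : ℂ) + (y : ℂ) * I)).im < 0)
    (hJ : ∃ u : ℂ, iteratedDeriv i f u = 0 ∧ u.im ≠ 0 ∧ α < u.re ∧ u.re < β)
    (hout : ∀ a : ℂ, iteratedDeriv i f a = 0 → 0 < a.im → α < a.re + a.im → a.re - a.im < β → R / 2 < |a.re - x₀| + a.im →
      (max (|a.re - x₀| - R / 2) 0) ^ 2 + (i : ℝ) * a.im ^ 2 ≤ (i : ℝ) * Hs ^ 2) :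
    HungBox f x₀ R Hs i := by
  obtain ⟨u, hu, huim, huα, huβ⟩ := hJ
  have hR := signedRect_of_cuts hE hnz ⟨u, hu⟩ hlt hFα hFβ hdα hdβ hsα hsβ
  exact ⟨α, β, Hs + 1, hαr, hβr, hR, ⟨u, mem_box_of_zero hE hnz hu huα huβ, hu, huim⟩, hangClause_of_offColumn hE hnz hout⟩

/-! ## §3 The SELF-shadow door (right-hand version with its corollaries; the left-hand mirror `hungBox_of_selfShadowL`) -/

/-- ★★ SELF-SHADOW DOOR (right).  Legal frame, `f^{(i)} ≢ 0`, an upper column couple `c` (typically with `x₀ + R/2 < Re c + Im c`: its own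
disc covers the right column side — the hypothesis is not needed for the conclusion), a left cut `α ∈ [x₀ − R/2, Re c)` signed on `(0, Hs]` with
good feet, good feet at the TANGENT ABSCISSA `β := Re c + Im c`, no zero's open shadow containing `β` (for `c` itself this is equality), and every
upper zero whose disc pokes out of the column with shadow meeting `(α, β)` a level-`i` band point ⇒ `HungBox f x₀ R Hs i`.
Range: `β ≤ x₀ + R/2 + Hs ≤ x₀ + R ≤ x₀ + (i+3)R/2`. -/
theorem hungBox_of_selfShadowR {η : ℝ} {f : ℂ → ℂ} {x₀ s hmax R Hs : ℝ} {B i : ℕ} (hE : EngineHyps5 2 η f x₀ s hmax R Hs B)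
    (hnz : iteratedDeriv i f ≠ 0) {c : ℂ} (hc : iteratedDeriv i f c = 0) (hcpos : 0 < c.im) (hccol : |c.re - x₀| < R / 2)
    {α : ℝ} (hα : x₀ - R / 2 ≤ α) (hαc : α < c.re)
    (hFα : iteratedDeriv i f α ≠ 0) (hdα : deriv (iteratedDeriv i f) α ≠ 0)
    (hsα : ∀ y ∈ Ioc (0 : ℝ) Hs,
      (deriv (iteratedDeriv i f) ((α : ℂ) + (y : ℂ) * I) / iteratedDeriv i f ((α : ℂ) + (y : ℂ) * I)).im < 0)
    (hFβ : iteratedDeriv i f ((c.re + c.im : ℝ) : ℂ) ≠ 0) (hdβ : deriv (iteratedDeriv i f) ((c.re + c.im : ℝ) : ℂ) ≠ 0)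
    (hT : ∀ a : ℂ, iteratedDeriv i f a = 0 → a.im ≠ 0 → |a.im| ≤ |c.re + c.im - a.re|)
    (hout : ∀ a : ℂ, iteratedDeriv i f a = 0 → 0 < a.im → α < a.re + a.im → a.re - a.im < c.re + c.im → R / 2 < |a.re - x₀| + a.im →
      (max (|a.re - x₀| - R / 2) 0) ^ 2 + (i : ℝ) * a.im ^ 2 ≤ (i : ℝ) * Hs ^ 2) :
    HungBox f x₀ R Hs i := by
  have hRpos : 0 < R := R_pos_of_engine hE
  have hHsR : 2 * Hs ≤ R := hE.2.2.2.2.2.2.2.2.2.1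
  have hi0 : (0 : ℝ) ≤ (i : ℝ) := by positivity
  have hcHs : c.im ≤ Hs := by
    have h1 := abs_im_le_of_level hE hnz hc
    rwa [abs_of_pos hcpos] at h1
  have hcre : c.re < x₀ + R / 2 := by linarith [(abs_lt.1 hccol).2]
  have hiR : R ≤ ((i : ℝ) + 3) * R / 2 := by nlinarith
  have hβr : c.re + c.im ≤ x₀ + ((i : ℝ) + 3) * R / 2 := by linarith
  have hαr : x₀ - ((i : ℝ) + 3) * R / 2 ≤ α := by linarith
  have hlt : α < c.re + c.im := by linarith
  have hS : ¬ Shadowed f Hs i (c.re + c.im) := not_shadowed_of_discs i hT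
  have hsβ := signedCut_of_not_shadowed hE i ⟨c, hc⟩ hS
  exact hungBox_of_cuts_inBand hE hnz hαr hβr hlt hFα hFβ hdα hdβ hsα hsβ ⟨c, hc, hcpos.ne', hαc, by linarith⟩ hout

/-- ★ SELF-SHADOW DOOR (left; mirror of `hungBox_of_selfShadowR`): upper column couple `c`, a right cut `β ∈ (Re c, x₀ + R/2]`, good feet and
no open shadow at the left tangent abscissa `α := Re c − Im c`, out-of-column intruders in band ⇒ `HungBox f x₀ R Hs i`. -/
theorem hungBox_of_selfShadowL {η : ℝ} {f : ℂ → ℂ} {x₀ s hmax R Hs : ℝ} {B i : ℕ} (hE : EngineHyps5 2 η f x₀ s hmax R Hs B)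
    (hnz : iteratedDeriv i f ≠ 0) {c : ℂ} (hc : iteratedDeriv i f c = 0) (hcpos : 0 < c.im) (hccol : |c.re - x₀| < R / 2)
    {β : ℝ} (hβ : β ≤ x₀ + R / 2) (hcβ : c.re < β)
    (hFβ : iteratedDeriv i f β ≠ 0) (hdβ : deriv (iteratedDeriv i f) β ≠ 0)
    (hsβ : ∀ y ∈ Ioc (0 : ℝ) Hs,
      (deriv (iteratedDeriv i f) ((β : ℂ) + (y : ℂ) * I) / iteratedDeriv i f ((β : ℂ) + (y : ℂ) * I)).im < 0)
    (hFα : iteratedDeriv i f ((c.re - c.im : ℝ) : ℂ) ≠ 0) (hdα : deriv (iteratedDeriv i f) ((c.re - c.im : ℝ) : ℂ) ≠ 0)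
    (hT : ∀ a : ℂ, iteratedDeriv i f a = 0 → a.im ≠ 0 → |a.im| ≤ |c.re - c.im - a.re|)
    (hout : ∀ a : ℂ, iteratedDeriv i f a = 0 → 0 < a.im → c.re - c.im < a.re + a.im → a.re - a.im < β → R / 2 < |a.re - x₀| + a.im →
      (max (|a.re - x₀| - R / 2) 0) ^ 2 + (i : ℝ) * a.im ^ 2 ≤ (i : ℝ) * Hs ^ 2) :
    HungBox f x₀ R Hs i := by
  have hRpos : 0 < R := R_pos_of_engine hE
  have hHsR : 2 * Hs ≤ R := hE.2.2.2.2.2.2.2.2.2.1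
  have hi0 : (0 : ℝ) ≤ (i : ℝ) := by positivity
  have hcHs : c.im ≤ Hs := by
    have h1 := abs_im_le_of_level hE hnz hc
    rwa [abs_of_pos hcpos] at h1
  have hcre : x₀ - R / 2 < c.re := by linarith [(abs_lt.1 hccol).1]
  have hiR : R ≤ ((i : ℝ) + 3) * R / 2 := by nlinarith
  have hαr : x₀ - ((i : ℝ) + 3) * R / 2 ≤ c.re - c.im := by linarith
  have hβr : β ≤ x₀ + ((i : ℝ) + 3) * R / 2 := by linarith
  have hlt : c.re - c.im < β := by linarith
  have hS : ¬ Shadowed f Hs i (c.re - c.im) := not_shadowed_of_discs i hT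
  have hsα := signedCut_of_not_shadowed hE i ⟨c, hc⟩ hS
  exact hungBox_of_cuts_inBand hE hnz hαr hβr hlt hFα hFβ hdα hdβ hsα hsβ ⟨c, hc, hcpos.ne', by linarith, hcβ⟩ hout

/-- ★ SELF ⇒ successor-or-`ReadyR2` AT LEVEL `i` (`c` itself is the band state the hung-box door wants: column immunity `stTrkDQ_of_column`;
`ReadyR2` is state-free, so it is reported at any `v`). -/
theorem succ_or_readyR2_of_selfShadowR {η : ℝ} {f : ℂ → ℂ} {x₀ s hmax R Hs : ℝ} {B i : ℕ} (v : ℂ)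
    (hE : EngineHyps5 2 η f x₀ s hmax R Hs B)
    (hnz : iteratedDeriv i f ≠ 0) {c : ℂ} (hc : iteratedDeriv i f c = 0) (hcpos : 0 < c.im) (hccol : |c.re - x₀| < R / 2)
    {α : ℝ} (hα : x₀ - R / 2 ≤ α) (hαc : α < c.re)
    (hFα : iteratedDeriv i f α ≠ 0) (hdα : deriv (iteratedDeriv i f) α ≠ 0)
    (hsα : ∀ y ∈ Ioc (0 : ℝ) Hs,
      (deriv (iteratedDeriv i f) ((α : ℂ) + (y : ℂ) * I) / iteratedDeriv i f ((α : ℂ) + (y : ℂ) * I)).im < 0)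
    (hFβ : iteratedDeriv i f ((c.re + c.im : ℝ) : ℂ) ≠ 0) (hdβ : deriv (iteratedDeriv i f) ((c.re + c.im : ℝ) : ℂ) ≠ 0)
    (hT : ∀ a : ℂ, iteratedDeriv i f a = 0 → a.im ≠ 0 → |a.im| ≤ |c.re + c.im - a.re|)
    (hout : ∀ a : ℂ, iteratedDeriv i f a = 0 → 0 < a.im → α < a.re + a.im → a.re - a.im < c.re + c.im → R / 2 < |a.re - x₀| + a.im →
      (max (|a.re - x₀| - R / 2) 0) ^ 2 + (i : ℝ) * a.im ^ 2 ≤ (i : ℝ) * Hs ^ 2) :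
    (∃ u : ℂ, StTrkDQ η f x₀ s hmax R Hs B (i + 1) u) ∨ ReadyR2 η f x₀ s hmax R Hs B i v := by
  have hB := hungBox_of_selfShadowR hE hnz hc hcpos hccol hα hαc hFα hdα hsα hFβ hdβ hT hout
  have hcst : StTrkDQ η f x₀ s hmax R Hs B i c := stTrkDQ_of_column hE hnz hc hcpos hccol.le
  rcases succ_or_readyR2_of_hungBox hE hcst hB with h | h
  · exact Or.inl h
  · exact Or.inr (stateFree_readyR2 η f x₀ s hmax R Hs B i c v h)

/-! ## §4 The push: lineage continuation through a self level, and what is missing for `i₀ < j` -/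

/-- ★ LINEAGE CONTINUATION THROUGH A SELF LEVEL.  Same data, level `i` not `WindowReady`, and NO off-axis zero of `f^{(i+1)}` in the cap
`[x₀ + R/2, Re c + Im c)` (instrumentable) ⇒ a COLUMN couple at level `i+1` (the child that ¬local A puts in the open self box lies left of
the wall), so `colCouple_succ_of_cuttable` / `succ_of_columnCuttable` resume at level `i+1`. -/
theorem colCouple_succ_of_selfShadowR {η : ℝ} {f : ℂ → ℂ} {x₀ s hmax R Hs : ℝ} {B i : ℕ} (v : ℂ)
    (hE : EngineHyps5 2 η f x₀ s hmax R Hs B)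
    (hnz : iteratedDeriv i f ≠ 0) {c : ℂ} (hc : iteratedDeriv i f c = 0) (hcpos : 0 < c.im) (hccol : |c.re - x₀| < R / 2)
    {α : ℝ} (hα : x₀ - R / 2 ≤ α) (hαc : α < c.re)
    (hFα : iteratedDeriv i f α ≠ 0) (hdα : deriv (iteratedDeriv i f) α ≠ 0)
    (hsα : ∀ y ∈ Ioc (0 : ℝ) Hs,
      (deriv (iteratedDeriv i f) ((α : ℂ) + (y : ℂ) * I) / iteratedDeriv i f ((α : ℂ) + (y : ℂ) * I)).im < 0)
    (hFβ : iteratedDeriv i f ((c.re + c.im : ℝ) : ℂ) ≠ 0) (hdβ : deriv (iteratedDeriv i f) ((c.re + c.im : ℝ) : ℂ) ≠ 0)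
    (hT : ∀ a : ℂ, iteratedDeriv i f a = 0 → a.im ≠ 0 → |a.im| ≤ |c.re + c.im - a.re|)
    (hnW : ¬ WindowReady η f x₀ s hmax R Hs B i v)
    (hcap : ∀ ρ : ℂ, iteratedDeriv (i + 1) f ρ = 0 → ρ.im ≠ 0 → x₀ + R / 2 ≤ ρ.re → ρ.re < c.re + c.im → False) :
    ColCouple f x₀ R (i + 1) := by
  have hRpos : 0 < R := R_pos_of_engine hE
  have hHsR : 2 * Hs ≤ R := hE.2.2.2.2.2.2.2.2.2.1
  have hi0 : (0 : ℝ) ≤ (i : ℝ) := by positivity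
  have hcHs : c.im ≤ Hs := by
    have h1 := abs_im_le_of_level hE hnz hc
    rwa [abs_of_pos hcpos] at h1
  have hcre : c.re < x₀ + R / 2 := by linarith [(abs_lt.1 hccol).2]
  have hiR : R ≤ ((i : ℝ) + 3) * R / 2 := by nlinarith
  have hβr : c.re + c.im ≤ x₀ + ((i : ℝ) + 3) * R / 2 := by linarith
  have hαr : x₀ - ((i : ℝ) + 3) * R / 2 ≤ α := by linarith
  have hlt : α < c.re + c.im := by linarith
  have hS : ¬ Shadowed f Hs i (c.re + c.im) := not_shadowed_of_discs i hT
  have hsβ := signedCut_of_not_shadowed hE i ⟨c, hc⟩ hS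
  have hR := signedRect_of_cuts hE hnz ⟨c, hc⟩ hlt hFα hFβ hdα hdβ hsα hsβ
  have hJ : ∃ u ∈ Ioo α (c.re + c.im) ×ℂ Ioo (-(Hs + 1)) (Hs + 1), iteratedDeriv i f u = 0 ∧ u.im ≠ 0 :=
    ⟨c, mem_box_of_zero hE hnz hc hαc (by linarith), hc, hcpos.ne'⟩
  rcases offAxisZero_or_windowReady v hαr hβr hR hJ with ⟨ρ, hρ, hz, hρim⟩ | hW
  · rw [mem_reProdIm] at hρ
    have hρre : ρ.re < x₀ + R / 2 := by
      by_contra hge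
      push Not at hge
      exact hcap ρ hz hρim hge hρ.1.2
    have hα' : x₀ - R / 2 < ρ.re := lt_of_le_of_lt hα hρ.1.1
    exact ⟨ρ, hz, hρim, abs_lt.2 ⟨by linarith, by linarith⟩⟩
  · exact absurd hW hnW

/-- ★ THE PUSH, as far as the cumulative data carry it.  Under the crux's binder ¬`ReadyR2` at level `j` and SELF data at a level `i₀ ≤ j`:
a level-`(i₀+1)` band state exists — which is the successor the crux asks for IFF `i₀ = j` (instantiate `i₀ := j`).  For `i₀ < j` see the
module docstring: the missing datum is a per-level door at levels `i₀+1 … j` (e.g. `colCouple_succ_of_selfShadowR` + cuttability above). -/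
theorem succ_of_selfShadowR_le {η : ℝ} {f : ℂ → ℂ} {x₀ s hmax R Hs : ℝ} {B j i₀ : ℕ} (v : ℂ)
    (hE : EngineHyps5 2 η f x₀ s hmax R Hs B) (hnR : ¬ ReadyR2 η f x₀ s hmax R Hs B j v) (hi : i₀ ≤ j)
    {c : ℂ} (hc : iteratedDeriv i₀ f c = 0) (hcpos : 0 < c.im) (hccol : |c.re - x₀| < R / 2)
    {α : ℝ} (hα : x₀ - R / 2 ≤ α) (hαc : α < c.re)
    (hFα : iteratedDeriv i₀ f α ≠ 0) (hdα : deriv (iteratedDeriv i₀ f) α ≠ 0)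
    (hsα : ∀ y ∈ Ioc (0 : ℝ) Hs,
      (deriv (iteratedDeriv i₀ f) ((α : ℂ) + (y : ℂ) * I) / iteratedDeriv i₀ f ((α : ℂ) + (y : ℂ) * I)).im < 0)
    (hFβ : iteratedDeriv i₀ f ((c.re + c.im : ℝ) : ℂ) ≠ 0) (hdβ : deriv (iteratedDeriv i₀ f) ((c.re + c.im : ℝ) : ℂ) ≠ 0)
    (hT : ∀ a : ℂ, iteratedDeriv i₀ f a = 0 → a.im ≠ 0 → |a.im| ≤ |c.re + c.im - a.re|)
    (hout : ∀ a : ℂ, iteratedDeriv i₀ f a = 0 → 0 < a.im → α < a.re + a.im → a.re - a.im < c.re + c.im → R / 2 < |a.re - x₀| + a.im →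
      (max (|a.re - x₀| - R / 2) 0) ^ 2 + (i₀ : ℝ) * a.im ^ 2 ≤ (i₀ : ℝ) * Hs ^ 2) :
    ∃ u : ℂ, StTrkDQ η f x₀ s hmax R Hs B (i₀ + 1) u := by
  have hnRi : ¬ ReadyR2 η f x₀ s hmax R Hs B i₀ v := fun h => hnR (readyR2_mono h hi)
  have hnz := (iteratedDeriv_ne_zero_of_not_readyR2 hE i₀ v hnRi).1
  exact (succ_or_readyR2_of_selfShadowR v hE hnz hc hcpos hccol hα hαc hFα hdα hsα hFβ hdβ hT hout).resolve_right hnRi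

end RhW08.Lens1Shape
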